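import Summits.PneNP.PneNP.Theorems.OverlapGapAlgebraNoStableSectionGlue3
import Summits.PneNP.PneNP.Theorems.OverlapGapAlgebraNoStableSectionLadder
import Summits.PneNP.PneNP.Theorems.OverlapGapAlgebraNoStableSectionEntropy
import Summits.PneNP.PneNP.Theorems.OverlapGapAlgebraNoStableSectionCount
import Summits.PneNP.PneNP.Theorems.OverlapGapAlgebraNoStableSectionPathValid
import Summits.PneNP.PneNP.Theorems.OverlapGapAlgebraNoStableSectionIndep
import Summits.PneNP.PneNP.Theorems.OverlapGapAlgebraNoStableSectionEnergy

/-!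
# Crux `NoStableSection` (stmt-PneNP-2462) — PROVED (line `DartGame`)

`Summit.PneNP.PneNP.Theses.OverlapGapAlgebra.NoStableSection`: Bresler–Huang's ensemble multi-OGP
for random `k`-SAT (arXiv:2106.02129, Thm 2.6 / Props 4.6–4.7 / §5) read for an ARBITRARY section
`g`, at the typed density `5·2^k log k/k`. Assembled from the six landed stubs of the line
(`stub_ladderExtraction`, `stub_entropyToolkit`, `stub_condEntCount`, `stub_pathValidCount`,
`stub_indepCount`, `stub_energyBound`) by the lead's glue `glue_noStableSection`
(`OverlapGapAlgebraNoStableSectionGlue1..3`). Unconditional: no named facts.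
-/

namespace Summit.PneNP.PneNP.Theorems

set_option linter.dupNamespace false -- `Summit.PneNP.PneNP.…`: summit = sub-problem (D-0017)

open Summit.PneNP.PneNP.Cruxes.NoStableSection.DartGame

/-- **The crux `NoStableSection`** (item stmt-PneNP-2462 of route OverlapGapAlgebra): for
`k ≥ k₀` there are `η, ν, c > 0` such that, for all large `n`, `m = ⌊5·2^k log k/k · n⌋₊` and
EVERY map `g` from instances to assignments, the number of paths `Ψ` (k+1 i.i.d. literal arrays)
on which `g` is `ν`-valid at all `k·mk+1` splice points and moves `≤ ηn` between consecutive ones is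
`≤ e^{-cn} · #paths`. Witnesses: `η = 1/k²`, `ν = 4^{-k}`, `c = log k/(2k)`. -/
theorem noStableSection_proof : Summit.PneNP.PneNP.Theses.OverlapGapAlgebra.NoStableSection :=
  glue_noStableSection stub_ladderExtraction stub_entropyToolkit stub_condEntCount stub_pathValidCount
    stub_indepCount stub_energyBound

end Summit.PneNP.PneNP.Theorems
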